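import Summits.AtomisticToContinuum.BoseEinsteinCondensation.Theorems.BECThomsonPrincipleFibreConductanceStubBetaHolder
import Summits.AtomisticToContinuum.BoseEinsteinCondensation.Theorems.BECThomsonPrincipleFibreConductanceStubFlatteningLineCalculus
import Summits.AtomisticToContinuum.BoseEinsteinCondensation.Theorems.BECThomsonPrincipleFibreFubini
import HarnessLib

/-!
# Route `BECThomsonPrinciple`, crux `FibreConductance` (stmt-AtomisticToContinuum-9480),
# line `parseval-shell-bootstrap` (skeleton r4): the ITERATED-PRIMITIVE FLATTENING FLOW —
# objects and stub statements

Route-posited objects (D-0016 `<Route>Defs`-type file; base layers `BECThomsonPrincipleDefs.lean`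
(`fibreW`, `fibrePsi`, `fibreDensCost`, `HasWeakDiv`, …), the gen-1 line's `…CageDefs.lean`
(`ConditionalDensityMoments`, `DensityFlatteningCubic`, `BetaHolder`) and its line calculus
`…StubFlatteningLineCalculus.lean` (`lineAvg`, `linePrim`, `fluct`, `fibreDir`)). NOTHING IS
ASSERTED here: every `def … : Prop` below is a stub signature of the reshaped skeleton
`Cruxes/FibreConductance/Lines/parseval_shell_bootstrap.lean` (r4, lead c3), consumed only as the
type of a stub theorem or as a hypothesis of the sorry-free composition
`densityFlatteningCubic_of` proved at the end; the stub theorems land one per file under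
`Theorems/BECThomsonPrincipleFibreConductance<Stub>.lean` (`--supports` the crux item).

**Why (the reshape).** The line's density channel was `stub_densityFlattening` (`E_W D² ≤ KL²`,
whose proof needs infrared screening of the density channel at wavelength `L`) feeding
`stub_betaCorrector`. The gen-1 line's landed `stub_betaHolder : DensityFlatteningCubic →
ShellOccupation → BetaCorrectorBound` needs flattening only at the cubic-moment level
`∫_{cellN} W·D³ ≤ K L⁹`, and THAT follows deterministically from the shared k-free landscape input
`ConditionalDensityMoments` by the iterated-primitive flow (gen-1 line card; paper proof by its lead):
with `g = L³ψ²` and line averages `⟨·⟩_l` along the axes of particle `0`,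
`J₂ = ∫₀^{y₂}(ψ² − ⟨ψ²⟩₂)`, `J₁ = ∫₀^{y₁}(⟨ψ²⟩₂ − ⟨⟨ψ²⟩₂⟩₁)`, `J₀ = ∫₀^{y₀}(⟨⟨ψ²⟩₂⟩₁ − L⁻³)`
(each integrand has zero line integral, so `J` is torus-periodic; `div₀ J = ψ² − L⁻³`);
`|J_l| ≤ 2L⁻² × (iterated line average of g)` on the cell, so `D ≤ 4L⁻¹∫_cell(Σ⟨g⟩²)/g`,
`D³ ≤ 576 L³ ∫_cell (Σ⟨g⟩⁶) g⁻³` (Jensen on the cell), and `∫_{cellN} W·D³ ≤ 576·3√(C₁₂C₆)·L⁹` by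
Cauchy–Schwarz in the bath, Jensen for line averages and `ConditionalDensityMoments` at `p = 12, 6`.
So the line's residual landscape content becomes the SHARED `ConditionalDensityMoments` (plus
`GradientComparability`), converging with the lines `tagged-path-harnack-cage-moments` and
`conditional-law-poincare`.

Objects: `gDens` (`g = L³ψ²`), `gAvg1/2/3` (iterated line averages of `g` along axes `2, 1, 0`),
`flatFlow` (the flow above, `ℂ`-valued), `lineMomentIntegrand` (`(Σᵢ gAvgᵢ⁶)·g⁻³`). Statements:
`LineFubini` (cell integral of a line average = cell integral), `Avg3Const` (`gAvg3 ≡ 1`),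
`FlatFlowDiv` (weak divergence `ψ² − L⁻³gAvg3`), `FlatFlowCost` (`D³ ≤ 576L³∫_cell lineMomentIntegrand`),
`LineMomentBound` (`∫_{cellN} W·∫_cell lineMomentIntegrand ≤ K L⁶` for exact minimisers at low
density); the audit aliases `Goal.stub_*`; the composition `densityFlatteningCubic_of`.

References: the line cards `Cruxes/FibreConductance/Lines/parseval-shell-bootstrap.md`,
`…/tagged-path-harnack-cage-moments.md` (β-channel by Hölder, iterated-primitive flow);
G. B. Folland, *Real Analysis* (1999) §2.5–2.6 (Fubini–Tonelli, the calculus facts used).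
-/

noncomputable section

namespace Summit.AtomisticToContinuum.BoseEinsteinCondensation.Cruxes.FibreConductance.ParsevalShellBootstrap

open MeasureTheory
open scoped ENNReal
open Literature.MathematicalPhysics.QuantumManyBody.BoseGas
open Summit.AtomisticToContinuum.BoseEinsteinCondensation.Theses.BECThomsonPrinciple (FibreConductance)
open Summit.AtomisticToContinuum.BoseEinsteinCondensation.Cruxes.FibreConductance.TaggedPathHarnack
  (fibreDir linePt lineAvg linePrim fluct ConditionalDensityMoments DensityFlatteningCubic
    lineAvg_nonneg contDiff_lineAvg contDiff_linePrim contDiff_fluct)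

variable {m : ℕ} {L : ℝ}

/-! ## §0 Objects of the flattening flow -/

/-- The normalised conditional density `g = L³ψ²` (`= 1` for the free gas; the quantity whose
two-sided moments `ConditionalDensityMoments` controls). [folklore] -/
def gDens (L : ℝ) (Φ : PeriodicTrialState (m + 1) L) (X : Config (m + 1)) : ℝ :=
  L ^ 3 * fibrePsi Φ X ^ 2

/-- First iterated line average `⟨g⟩₂` (along the axis `x_{0,2}` of particle `0`). [folklore] -/
def gAvg1 (L : ℝ) (Φ : PeriodicTrialState (m + 1) L) : Config (m + 1) → ℝ :=
  lineAvg L 2 (gDens L Φ)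

/-- Second iterated line average `⟨⟨g⟩₂⟩₁` (a function of `x_{0,0}` and the bath). [folklore] -/
def gAvg2 (L : ℝ) (Φ : PeriodicTrialState (m + 1) L) : Config (m + 1) → ℝ :=
  lineAvg L 1 (gAvg1 L Φ)

/-- Third iterated line average `⟨⟨⟨g⟩₂⟩₁⟩₀` (a function of the bath only; `≡ 1`, `Avg3Const`).
[folklore] -/
def gAvg3 (L : ℝ) (Φ : PeriodicTrialState (m + 1) L) : Config (m + 1) → ℝ :=
  lineAvg L 0 (gAvg2 L Φ)

/-- **The iterated-primitive FLATTENING FLOW** `J = (J₀, J₁, J₂)` in the `x₀`-fibre: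
`J₀ = ∫₀^{x_{0,0}} L⁻³(⟨⟨g⟩₂⟩₁ − ⟨⟨⟨g⟩₂⟩₁⟩₀)`, `J₁ = ∫₀^{x_{0,1}} L⁻³(⟨g⟩₂ − ⟨⟨g⟩₂⟩₁)`,
`J₂ = ∫₀^{x_{0,2}} L⁻³(g − ⟨g⟩₂)` (line primitives of fluctuations about line averages, so each is
torus-periodic; `∂₀J₀ + ∂₁J₁ + ∂₂J₂ = ψ² − L⁻³⟨⟨⟨g⟩⟩⟩ = ψ² − L⁻³`). [folklore] -/
def flatFlow (L : ℝ) (Φ : PeriodicTrialState (m + 1) L) (X : Config (m + 1)) : Fin 3 → ℂ :=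
  ![((linePrim 0 (fluct (L ^ 3)⁻¹ L 0 (gAvg2 L Φ)) X : ℝ) : ℂ),
    ((linePrim 1 (fluct (L ^ 3)⁻¹ L 1 (gAvg1 L Φ)) X : ℝ) : ℂ),
    ((linePrim 2 (fluct (L ^ 3)⁻¹ L 2 (gDens L Φ)) X : ℝ) : ℂ)]

/-- The LINE-MOMENT INTEGRAND `(⟨g⟩₂⁶ + ⟨⟨g⟩₂⟩₁⁶ + ⟨⟨⟨g⟩₂⟩₁⟩₀⁶)·(g⁻¹)³` bounding `D³` pointwise
(`FlatFlowCost`) and paid by `ConditionalDensityMoments` (`LineMomentBound`). [folklore] -/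
def lineMomentIntegrand (L : ℝ) (Φ : PeriodicTrialState (m + 1) L) (X : Config (m + 1)) : ℝ :=
  (gAvg1 L Φ X ^ 6 + gAvg2 L Φ X ^ 6 + gAvg3 L Φ X ^ 6) * ((gDens L Φ X)⁻¹) ^ 3

/-! ### Regularity of the objects (used by the composition: the flow is measurable) -/

/-- `g` is `C¹` for a zero-free state (`L > 0`). [folklore] -/
theorem contDiff_gDens (hL : 0 < L) (Φ : PeriodicTrialState (m + 1) L) (hΦ : ∀ X, Φ.ψ X ≠ 0) :
    ContDiff ℝ 1 (gDens L Φ) :=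
  contDiff_const.mul ((contDiff_fibrePsi hL Φ hΦ).pow 2)

/-- `⟨g⟩₂` is `C¹`. [folklore] -/
theorem contDiff_gAvg1 (hL : 0 < L) (Φ : PeriodicTrialState (m + 1) L) (hΦ : ∀ X, Φ.ψ X ≠ 0) :
    ContDiff ℝ 1 (gAvg1 L Φ) :=
  contDiff_lineAvg L 2 (contDiff_gDens hL Φ hΦ)

/-- `⟨⟨g⟩₂⟩₁` is `C¹`. [folklore] -/
theorem contDiff_gAvg2 (hL : 0 < L) (Φ : PeriodicTrialState (m + 1) L) (hΦ : ∀ X, Φ.ψ X ≠ 0) :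
    ContDiff ℝ 1 (gAvg2 L Φ) :=
  contDiff_lineAvg L 1 (contDiff_gAvg1 hL Φ hΦ)

/-- `⟨⟨⟨g⟩₂⟩₁⟩₀` is `C¹`. [folklore] -/
theorem contDiff_gAvg3 (hL : 0 < L) (Φ : PeriodicTrialState (m + 1) L) (hΦ : ∀ X, Φ.ψ X ≠ 0) :
    ContDiff ℝ 1 (gAvg3 L Φ) :=
  contDiff_lineAvg L 0 (contDiff_gAvg2 hL Φ hΦ)

/-- The components of the flattening flow, as real functions. [folklore] -/
theorem flatFlow_apply (L : ℝ) (Φ : PeriodicTrialState (m + 1) L) (X : Config (m + 1)) :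
    flatFlow L Φ X 0 = ((linePrim 0 (fluct (L ^ 3)⁻¹ L 0 (gAvg2 L Φ)) X : ℝ) : ℂ) ∧
      flatFlow L Φ X 1 = ((linePrim 1 (fluct (L ^ 3)⁻¹ L 1 (gAvg1 L Φ)) X : ℝ) : ℂ) ∧
        flatFlow L Φ X 2 = ((linePrim 2 (fluct (L ^ 3)⁻¹ L 2 (gDens L Φ)) X : ℝ) : ℂ) := by
  refine ⟨rfl, rfl, ?_⟩
  rfl

/-- The flattening flow is continuous (each component is a line primitive of a `C¹` function).
[folklore] -/
theorem continuous_flatFlow (hL : 0 < L) (Φ : PeriodicTrialState (m + 1) L) (hΦ : ∀ X, Φ.ψ X ≠ 0) :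
    Continuous (flatFlow L Φ) := by
  have h0 := (contDiff_linePrim 0 (contDiff_fluct (L ^ 3)⁻¹ L 0 (contDiff_gAvg2 hL Φ hΦ))).continuous
  have h1 := (contDiff_linePrim 1 (contDiff_fluct (L ^ 3)⁻¹ L 1 (contDiff_gAvg1 hL Φ hΦ))).continuous
  have h2 := (contDiff_linePrim 2 (contDiff_fluct (L ^ 3)⁻¹ L 2 (contDiff_gDens hL Φ hΦ))).continuous
  refine continuous_pi fun l => ?_
  fin_cases l
  · exact Complex.continuous_ofReal.comp h0
  · exact Complex.continuous_ofReal.comp h1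
  · exact Complex.continuous_ofReal.comp h2

/-- The flattening flow is measurable. [folklore] -/
theorem measurable_flatFlow (hL : 0 < L) (Φ : PeriodicTrialState (m + 1) L) (hΦ : ∀ X, Φ.ψ X ≠ 0) :
    Measurable (flatFlow L Φ) :=
  (continuous_flatFlow hL Φ hΦ).measurable

/-! ## §1 Statements of the deterministic stubs of the flattening chain -/

/-- **Statement `LineFubini` (part of `stub_lineFubini`; M; deterministic).** For every continuous
`f ≥ 0` on configuration space, every fibre axis `l` and every configuration `X`, integrating the
LINE AVERAGE `⟨f⟩_l` over the fibre cell of `X` gives the integral of `f` over that cell: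
`∫_cell ⟨f⟩_l(X[0↦y]) dy = ∫_cell f(X[0↦y]) dy` (Fubini–Tonelli on `[0,L)³ = [0,L) × [0,L)²` along
the axis `l`, and translation of the `l`-th coordinate). Verbatim the signature gen 1 registered as
`lintegral_cell_ofReal_lineAvg`. Why it might fail: only coordinate bookkeeping on
`EuclideanSpace ℝ (Fin 3)` (pattern: `lintegral_cell_comp_coord0` in `Negative/OneDimAxis`).
(Refs: Folland, *Real Analysis*, Thm. 2.37.) -/
def LineFubini : Prop :=
  ∀ (m : ℕ) (L : ℝ), 0 < L → ∀ (l : Fin 3) (f : Config (m + 1) → ℝ), Continuous f →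
    (∀ Y, 0 ≤ f Y) → ∀ X : Config (m + 1),
      ∫⁻ y in cell L, ENNReal.ofReal (lineAvg L l f (Function.update X 0 y)) =
        ∫⁻ y in cell L, ENNReal.ofReal (f (Function.update X 0 y))

/-- **Statement `Avg3Const` (part of `stub_lineFubini`; S/M; deterministic).** The triple iterated
line average of `g = L³ψ²` is identically `1` for a zero-free state: it is constant along all three
axes of particle `0` (line averages are constant along their own line and inherit the constancy of
their integrand along the other axes: `lineAvg_add_smul`, `lineAvg_add_of_apply_eq_zero`), so
`L³·⟨⟨⟨g⟩⟩⟩(X) = ∫_cell ⟨⟨⟨g⟩⟩⟩ = ∫_cell g = L³∫_cell ψ² = L³` by `LineFubini` three times and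
`integral_fibrePsi_sq`. Why it might fail: only the `Function.update`/`fibreDir` bookkeeping.
(Refs: Folland, *Real Analysis*, Thm. 2.37.) -/
def Avg3Const : Prop :=
  ∀ (m : ℕ) (L : ℝ), 0 < L → ∀ Φ : PeriodicTrialState (m + 1) L, (∀ X, Φ.ψ X ≠ 0) →
    ∀ X : Config (m + 1), gAvg3 L Φ X = 1

/-- **Statement of `stub_flatFlowDiv` — WEAK DIVERGENCE OF THE FLATTENING FLOW (M/L; deterministic).**
For `L > 0` and a zero-free state, `flatFlow` has weak `x₀`-divergence `ψ² − L⁻³⟨⟨⟨g⟩⟩⟩` on the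
torus (`HasWeakDiv`, tests `C¹` and periodic in every particle): each `J_l` is the line primitive of
a fluctuation about a line average, hence `C¹` (`contDiff_linePrim`) and torus-periodic
(`linePrim_periodic`, `intervalIntegral_fluct`), with `∂_{0,l}J_l =` its integrand
(`fderiv_linePrim_fibreDir`); periodic integration by parts at particle `0`
(`integral_cellN_fderiv_zero` applied to `J_l·η`) and the telescoping
`(⟨⟨g⟩⟩₁ − ⟨⟨⟨g⟩⟩⟩₀) + (⟨g⟩₂ − ⟨⟨g⟩⟩₁) + (g − ⟨g⟩₂) = g − ⟨⟨⟨g⟩⟩⟩` give the claim. Why it might fail: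
only bookkeeping (the real→complex coercion inside `fderiv`, integrability on `cellN`).
(Refs: Folland, *Real Analysis*, §2.6 (integration by parts); LyonsPeres2016 Ch. 2 (flows).) -/
def FlatFlowDiv : Prop :=
  ∀ (m : ℕ) (L : ℝ), 0 < L → ∀ Φ : PeriodicTrialState (m + 1) L, (∀ X, Φ.ψ X ≠ 0) →
    HasWeakDiv L (flatFlow L Φ)
      (fun X => ((fibrePsi Φ X ^ 2 - (L ^ 3)⁻¹ * gAvg3 L Φ X : ℝ) : ℂ))

/-- **Statement of `stub_flatFlowCost` — CUBED FIBRE COST OF THE FLATTENING FLOW (M; deterministic).**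
For `L > 0`, a zero-free state and a configuration `X` in the cell, the fibre cost
`D(X̂) = ∫_cell |J|²/ψ² dy` of `flatFlow` satisfies `D³ ≤ 576 L³ ∫_cell (Σᵢ⟨g⟩ᵢ⁶) g⁻³ dy`:
pointwise on the closed cell `|J_l| ≤ 2L·L⁻³·(line average)` (`abs_linePrim_fluct_le`, integrands
`≥ 0`), so `Σ|J_l|² ≤ 4L⁻⁴(⟨g⟩₂² + ⟨⟨g⟩⟩₁² + ⟨⟨⟨g⟩⟩⟩₀²)` and `|J|²/ψ² ≤ 4L⁻¹(Σ⟨g⟩ᵢ²)/g`; then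
`(∫_cell F)³ ≤ |cell|² ∫_cell F³` (Hölder `(3, 3/2)` against `1`, `|cell| = L³`) and
`(a+b+c)³ ≤ 9(a³+b³+c³)`. Why it might fail: only `ℝ≥0∞` bookkeeping. (Refs: Folland, *Real
Analysis*, Thm. 6.2 (Hölder).) -/
def FlatFlowCost : Prop :=
  ∀ (m : ℕ) (L : ℝ), 0 < L → ∀ Φ : PeriodicTrialState (m + 1) L, (∀ X, Φ.ψ X ≠ 0) →
    ∀ X ∈ cellN (m + 1) L,
      fibreDensCost Φ (flatFlow L Φ) X ^ 3 ≤
        ENNReal.ofReal (576 * L ^ 3) *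
          ∫⁻ y in cell L, ENNReal.ofReal (lineMomentIntegrand L Φ (Function.update X 0 y))

/-- **Statement `LineMomentBound` (conclusion of `stub_lineMoments`; the bath moment the flattening
flow costs).** For bounded repulsive finite-range `v` there are `ρ₀, K, N₀` such that for every exact
zero-free minimiser at density `≤ ρ₀` (no window),
`∫_{cellN} W(X̂)·(∫_cell (Σᵢ⟨g⟩ᵢ⁶ g⁻³)(X[0↦y]) dy) dX ≤ K L⁶`. From `ConditionalDensityMoments`:
the inner fibre integral spreads to `L³∫_{cellN} W·(Σᵢ⟨g⟩ᵢ⁶)g⁻³` (`lintegral_cellN_eq_fibre_average`,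
`W` fibre-constant); Cauchy–Schwarz in the bath `∫W⟨g⟩ᵢ⁶g⁻³ ≤ (∫W⟨g⟩ᵢ¹²)^{1/2}(∫Wg⁻⁶)^{1/2}`;
Jensen `⟨g⟩ᵢ¹² ≤ ⟨g¹²⟩ᵢ` (iterated) and `LineFubini` (iterated) turn `∫W⟨g¹²⟩ᵢ` into `∫Wg¹²`; the
moments `∫W(g¹² + g⁻¹²) ≤ C₁₂L³`, `∫W(g⁶ + g⁻⁶) ≤ C₆L³` are `ConditionalDensityMoments` at
`p = 12, 6` (same `Φ`; `ρ₀ = min`, `N₀ = max`), whence `K = 3√(C₁₂C₆)`. Why it might fail: only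
bookkeeping; false without (H1) exactly as `ConditionalDensityMoments` is. (Refs: Folland, *Real
Analysis*, Thm. 2.37, Thm. 6.2; Jensen's inequality.) -/
def LineMomentBound : Prop :=
  ∀ v : ℝ → ℝ≥0∞, IsRepulsiveFiniteRange v → (∃ B : ℝ, ∀ r, v r ≤ ENNReal.ofReal B) →
    ∃ ρ₀ K : ℝ, 0 < ρ₀ ∧ 0 < K ∧ ∃ N₀ : ℕ, ∀ m : ℕ, N₀ ≤ m + 1 →
      ∀ L : ℝ, 0 < L → ((m + 1 : ℕ) : ℝ) ≤ ρ₀ * L ^ 3 →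
        ∀ Φ : PeriodicTrialState (m + 1) L,
          periodicEnergy v Φ = periodicGroundStateEnergy v (m + 1) L → (∀ X, Φ.ψ X ≠ 0) →
            ∫⁻ X in cellN (m + 1) L, ENNReal.ofReal (fibreW Φ X) *
                ∫⁻ y in cell L, ENNReal.ofReal (lineMomentIntegrand L Φ (Function.update X 0 y)) ≤
              ENNReal.ofReal (K * L ^ 6)

/-! ### Audit names of the stub statements (`Goal.stub_x` = statement of the registered `stub_x`) -/

namespace Goal

/-- Statement of `stub_lineFubini`: the line Fubini identity and the constancy of the triple
average. -/
abbrev stub_lineFubini : Prop := LineFubini ∧ Avg3Const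
/-- Statement of `stub_flatFlowDiv`. -/
abbrev stub_flatFlowDiv : Prop := FlatFlowDiv
/-- Statement of `stub_flatFlowCost`. -/
abbrev stub_flatFlowCost : Prop := FlatFlowCost
/-- Statement of `stub_lineMoments`: `LineFubini → ConditionalDensityMoments → LineMomentBound`. -/
abbrev stub_lineMoments : Prop := LineFubini → ConditionalDensityMoments → LineMomentBound
/-- Statement of `stub_conditionalDensityMoments` (the shared k-free landscape input of the lines
`tagged-path-harnack-cage-moments` / `conditional-law-poincare`, verbatim). -/
abbrev stub_conditionalDensityMoments : Prop := ConditionalDensityMoments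
/-- Statement of the bookkeeping composition `flattening_compose`: the four deterministic stubs and
`ConditionalDensityMoments` give `DensityFlatteningCubic` (proved below as
`densityFlatteningCubic_of`). -/
abbrev flattening_compose : Prop :=
  stub_lineFubini → stub_flatFlowDiv → stub_flatFlowCost → stub_lineMoments →
    stub_conditionalDensityMoments → DensityFlatteningCubic

end Goal

/-! ## §2 The composition (proved): the flattening chain gives `DensityFlatteningCubic` -/

/-- **THE FLATTENING CHAIN ⇒ `DensityFlatteningCubic`.** With `J = flatFlow` (measurable, weak
divergence `ψ² − L⁻³` once `⟨⟨⟨g⟩⟩⟩ ≡ 1`), `∫_{cellN} W·D³ ≤ ∫_{cellN} W·576L³∫_cell(Σ⟨g⟩ᵢ⁶g⁻³)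
≤ 576 K L⁹`. Pure bookkeeping over the four deterministic stubs and the landscape input. [folklore] -/
theorem densityFlatteningCubic_of (hlf : LineFubini ∧ Avg3Const) (hdiv : FlatFlowDiv)
    (hcost : FlatFlowCost) (hmom : LineFubini → ConditionalDensityMoments → LineMomentBound)
    (hcdm : ConditionalDensityMoments) : DensityFlatteningCubic := by
  intro v hv hB
  obtain ⟨ρ₀, K, hρ₀, hK, N₀, hmain⟩ := hmom hlf.1 hcdm v hv hB
  refine ⟨ρ₀, 576 * K, hρ₀, by positivity, N₀, fun m hm L hL hρ Φ hE hz => ?_⟩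
  refine ⟨flatFlow L Φ, measurable_flatFlow hL Φ hz, ?_, ?_⟩
  · -- weak divergence: `ψ² − L⁻³·⟨⟨⟨g⟩⟩⟩ = ψ² − L⁻³`
    have hσ : (fun X => ((fibrePsi Φ X ^ 2 - (L ^ 3)⁻¹ * gAvg3 L Φ X : ℝ) : ℂ)) =
        fun X => ((fibrePsi Φ X ^ 2 - (L ^ 3)⁻¹ : ℝ) : ℂ) := by
      funext X
      rw [hlf.2 m L hL Φ hz X, mul_one]
    have h := hdiv m L hL Φ hz
    rwa [hσ] at h
  · -- the cubed cost
    have hc := hcost m L hL Φ hz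
    have hb := hmain m hm L hL hρ Φ hE hz
    calc ∫⁻ X in cellN (m + 1) L, ENNReal.ofReal (fibreW Φ X) * fibreDensCost Φ (flatFlow L Φ) X ^ 3
        ≤ ∫⁻ X in cellN (m + 1) L, ENNReal.ofReal (fibreW Φ X) * (ENNReal.ofReal (576 * L ^ 3) *
            ∫⁻ y in cell L, ENNReal.ofReal (lineMomentIntegrand L Φ (Function.update X 0 y))) :=
          setLIntegral_mono' (measurableSet_cellN (m + 1) L) fun X hX => by
            gcongr
            exact hc X hX
      _ = ENNReal.ofReal (576 * L ^ 3) * ∫⁻ X in cellN (m + 1) L, ENNReal.ofReal (fibreW Φ X) *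
            ∫⁻ y in cell L, ENNReal.ofReal (lineMomentIntegrand L Φ (Function.update X 0 y)) := by
          rw [← lintegral_const_mul' _ _ ENNReal.ofReal_ne_top]
          refine lintegral_congr fun X => ?_
          ring
      _ ≤ ENNReal.ofReal (576 * L ^ 3) * ENNReal.ofReal (K * L ^ 6) := by gcongr
      _ = ENNReal.ofReal (576 * K * L ^ 9) := by
          rw [← ENNReal.ofReal_mul (by positivity)]
          congr 1
          ring

/-- **Registered bookkeeping composition** (statement `Goal.flattening_compose`). [folklore] -/
theorem flattening_compose : Goal.flattening_compose :=
  fun hlf hdiv hcost hmom hcdm => densityFlatteningCubic_of hlf hdiv hcost hmom hcdm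

end Summit.AtomisticToContinuum.BoseEinsteinCondensation.Cruxes.FibreConductance.ParsevalShellBootstrap

end
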